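import Mathlib
import Summits.Ventures.PercRepro2.CoinKSureGate
import Summits.Ventures.PercRepro2.CoinChainMixLsm

/-!
# The coin-OPEN half of the chain functional is nonnegative
(blind cell PercRepro2, night-2 g16; proofs/NIGHT2-DARC.md §56.7)

For the chained OR-vertex (§56.1) write `R_ρ = ν · chainMix ent ent' ρ c d` for the κ-integrated
`R`-law and `G'_ρ = ν · chainMix ent ent' ρ c d'` for the κ-integrated gate (`c` the closure value,
`d = c(· + a)`, `d' = c(· + a + w)`); `chainMix ent ent' 1 c d'` is the WORLD-1 gate (the chain coin
open: `a` entered whenever `W` meets `ent ∪ ent'`).  The cleared functional `T(R, G')` is linear in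
the gate, `T(R_ρ, G'_ρ) = ρ·T(R_ρ, G'_1) + (1 − ρ)·T(R_ρ, G'_0)`, and THIS FILE proves the first
half: `T(R_ρ, G'_1) ≥ 0` — the pair `(R_ρ, G'_1)` with the entry set `ent ∪ ent'` satisfies every
hypothesis of the clean-state theorem `gate_functional_nonneg` (`R_ρ` log-supermodular by
`mixture_lsm`, `G'_1` likewise, the cross-Holley inequality termwise, equality off the entries).
The second half `T(R_ρ, G'_0)` is negative in general (§56.8): the chain itself stays open.
-/

namespace Summit.Ventures.PercRepro2.Coin

section ChainWorld1

variable {V : Type*} [DecidableEq V] {R : Type*} [Field R] [LinearOrder R] [IsStrictOrderedRing R]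

/-- `chainTheta` lies in `[0, 1]`. -/
lemma chainTheta_nonneg (ent ent' : Finset V) {ρ : R} (hρ0 : 0 ≤ ρ) (W : Finset V) :
    0 ≤ chainTheta ent ent' ρ W := by
  unfold chainTheta; split_ifs <;> linarith

/-- `chainTheta ≤ 1`. -/
lemma chainTheta_le_one (ent ent' : Finset V) {ρ : R} (hρ1 : ρ ≤ 1) (W : Finset V) :
    chainTheta ent ent' ρ W ≤ 1 := by
  unfold chainTheta; split_ifs <;> linarith

/-- The mixture is nonnegative. -/
lemma chainMix_nonneg (ent ent' : Finset V) {ρ : R} (hρ0 : 0 ≤ ρ) (hρ1 : ρ ≤ 1)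
    {c d : Finset V → R} (hc0 : ∀ W, 0 ≤ c W) (hd0 : ∀ W, 0 ≤ d W) (W : Finset V) :
    0 ≤ chainMix ent ent' ρ c d W := by
  unfold chainMix
  have h1 := chainTheta_nonneg ent ent' hρ0 W
  have h2 := chainTheta_le_one ent ent' hρ1 W
  exact add_nonneg (mul_nonneg (by linarith) (hc0 W)) (mul_nonneg h1 (hd0 W))

/-- The mixture is at least `d`. -/
lemma chainMix_ge (ent ent' : Finset V) {ρ : R} (hρ1 : ρ ≤ 1)
    {c d : Finset V → R} (hdc : ∀ W, d W ≤ c W) (W : Finset V) :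
    d W ≤ chainMix ent ent' ρ c d W := by
  unfold chainMix
  have h2 := chainTheta_le_one ent ent' hρ1 W
  have := hdc W
  nlinarith

omit [LinearOrder R] [IsStrictOrderedRing R] in
/-- Off the entries the mixture is `c`. -/
lemma chainMix_of_not_meet (ent ent' : Finset V) (ρ : R) (c d : Finset V → R) {W : Finset V}
    (h : ¬ ∃ r ∈ ent ∪ ent', r ∈ W) : chainMix ent ent' ρ c d W = c W := by
  have h0 : ¬ ∃ r ∈ ent, r ∈ W := fun ⟨r, hr, hrW⟩ => h ⟨r, Finset.mem_union_left _ hr, hrW⟩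
  have h1 : ¬ ∃ r ∈ ent', r ∈ W := fun ⟨r, hr, hrW⟩ => h ⟨r, Finset.mem_union_right _ hr, hrW⟩
  unfold chainMix chainTheta
  simp [h0, h1]

omit [LinearOrder R] [IsStrictOrderedRing R] in
/-- On the entered clusters the world-1 value (`ρ = 1`) is `d`. -/
lemma chainMix_one_of_meet (ent ent' : Finset V) (c d : Finset V → R) {W : Finset V}
    (h : ∃ r ∈ ent ∪ ent', r ∈ W) : chainMix ent ent' 1 c d W = d W := by
  unfold chainMix chainTheta
  by_cases h0 : ∃ r ∈ ent, r ∈ W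
  · simp [h0]
  · have h1 : ∃ r ∈ ent', r ∈ W := by
      obtain ⟨r, hr, hrW⟩ := h
      rcases Finset.mem_union.1 hr with hr | hr
      · exact absurd ⟨r, hr, hrW⟩ h0
      · exact ⟨r, hr, hrW⟩
    simp [h0, h1]

/-- The cross-Holley inequality between the world-1 gate value `d'` at an entered `s` and the
mixed `R`-value at any `t`: `d' s · m t ≤ m (s ∩ t) · d' (s ∪ t)`. -/
lemma chain_cross_holley (ent ent' : Finset V) (ρ : R) (hρ0 : 0 ≤ ρ) (hρ1 : ρ ≤ 1)
    (c d d' : Finset V → R) (hdc : ∀ W, d W ≤ c W)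
    (hcd' : ∀ s t, c s * d' t ≤ c (s ∩ t) * d' (s ∪ t))
    (hdd' : ∀ s t, d s * d' t ≤ d (s ∩ t) * d' (s ∪ t))
    (hd'0 : ∀ W, 0 ≤ d' W) (s t : Finset V) :
    d' s * chainMix ent ent' ρ c d t ≤ chainMix ent ent' ρ c d (s ∩ t) * d' (s ∪ t) := by
  have h1 : d' s * c t ≤ c (s ∩ t) * d' (s ∪ t) := by
    have := hcd' t s; rw [Finset.inter_comm, Finset.union_comm] at this; linarith
  have h2 : d' s * d t ≤ d (s ∩ t) * d' (s ∪ t) := by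
    have := hdd' t s; rw [Finset.inter_comm, Finset.union_comm] at this; linarith
  have hdc_i := hdc (s ∩ t)
  have hd'u := hd'0 (s ∪ t)
  have h3 : d (s ∩ t) * d' (s ∪ t) ≤ c (s ∩ t) * d' (s ∪ t) := mul_le_mul_of_nonneg_right hdc_i hd'u
  have hρ' : (0 : R) ≤ 1 - ρ := by linarith
  unfold chainMix chainTheta
  by_cases ht0 : ∃ r ∈ ent, r ∈ t <;> by_cases ht1 : ∃ r ∈ ent', r ∈ t <;>
    by_cases hi0 : ∃ r ∈ ent, r ∈ s ∩ t <;> by_cases hi1 : ∃ r ∈ ent', r ∈ s ∩ t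
  all_goals
    first
    | exact absurd (meets_inter_right hi0) ht0
    | exact absurd (meets_inter_right hi1) ht1
    | skip
  all_goals
    simp only [ht0, ht1, hi0, hi1, if_true, if_false, sub_self, zero_mul, sub_zero, one_mul,
      zero_add, add_zero]
  all_goals
    first
    | exact h1
    | exact le_trans h2 h3
    | nlinarith [mul_le_mul_of_nonneg_left h1 hρ', mul_le_mul_of_nonneg_left h2 hρ0,
        mul_le_mul_of_nonneg_left h3 hρ0]

/-- **THE COIN-OPEN HALF OF THE CHAIN FUNCTIONAL IS NONNEGATIVE.** With `G = ν · chainMix ρ c d`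
(the κ-integrated `R`-law) and `G' = ν · chainMix 1 c d'` (the world-1 gate), markers
`1[m₁ ∈ W]`, `1[m₂ ∈ W]`, the cleared functional is `≥ 0` — by `gate_functional_nonneg` with the
entry set `ent ∪ ent'`. -/
theorem chain_world1_nonneg (U ent ent' : Finset V) (ν c d d' : Finset V → R) (ρ : R)
    (hρ0 : 0 ≤ ρ) (hρ1 : ρ ≤ 1) (hν0 : ∀ W, 0 ≤ ν W)
    (hν : ∀ s ⊆ U, ∀ t ⊆ U, ν s * ν t ≤ ν (s ∩ t) * ν (s ∪ t))
    (hc0 : ∀ W, 0 ≤ c W) (hd0 : ∀ W, 0 ≤ d W) (hd'0 : ∀ W, 0 ≤ d' W)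
    (hdc : ∀ W, d W ≤ c W) (hd'c : ∀ W, d' W ≤ c W)
    (hcc : ∀ s t, c s * c t ≤ c (s ∩ t) * c (s ∪ t))
    (hdd : ∀ s t, d s * d t ≤ d (s ∩ t) * d (s ∪ t))
    (hd'd' : ∀ s t, d' s * d' t ≤ d' (s ∩ t) * d' (s ∪ t))
    (hcd : ∀ s t, c s * d t ≤ c (s ∩ t) * d (s ∪ t))
    (hcd' : ∀ s t, c s * d' t ≤ c (s ∩ t) * d' (s ∪ t))
    (hdd' : ∀ s t, d s * d' t ≤ d (s ∩ t) * d' (s ∪ t))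
    (hratio : ∀ s t, s ⊆ t → d s * c t ≤ c s * d t)
    (hratio' : ∀ s t, s ⊆ t → d' s * c t ≤ c s * d' t) (m₁ m₂ : V) :
    0 ≤ (∑ W ∈ U.powerset, ν W * chainMix ent ent' ρ c d W) ^ 2 *
          (∑ W ∈ U.powerset, ν W * chainMix ent ent' 1 c d' W *
            ((if m₁ ∈ W then (1 : R) else 0) * (if m₂ ∈ W then (1 : R) else 0)))
        - (∑ W ∈ U.powerset, ν W * chainMix ent ent' ρ c d W) *
          (∑ W ∈ U.powerset, ν W * chainMix ent ent' ρ c d W * (if m₁ ∈ W then (1 : R) else 0)) *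
          (∑ W ∈ U.powerset, ν W * chainMix ent ent' 1 c d' W * (if m₂ ∈ W then (1 : R) else 0))
        - (∑ W ∈ U.powerset, ν W * chainMix ent ent' ρ c d W) *
          (∑ W ∈ U.powerset, ν W * chainMix ent ent' ρ c d W * (if m₂ ∈ W then (1 : R) else 0)) *
          (∑ W ∈ U.powerset, ν W * chainMix ent ent' 1 c d' W * (if m₁ ∈ W then (1 : R) else 0))
        + (∑ W ∈ U.powerset, ν W * chainMix ent ent' ρ c d W * (if m₁ ∈ W then (1 : R) else 0)) *
          (∑ W ∈ U.powerset, ν W * chainMix ent ent' ρ c d W * (if m₂ ∈ W then (1 : R) else 0)) *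
          (∑ W ∈ U.powerset, ν W * chainMix ent ent' 1 c d' W) := by
  set G : Finset V → R := fun W => ν W * chainMix ent ent' ρ c d W with hGdef
  set G' : Finset V → R := fun W => ν W * chainMix ent ent' 1 c d' W with hG'def
  have hm0 : ∀ W, 0 ≤ chainMix ent ent' ρ c d W := chainMix_nonneg ent ent' hρ0 hρ1 hc0 hd0
  have hm'0 : ∀ W, 0 ≤ chainMix ent ent' 1 c d' W :=
    chainMix_nonneg ent ent' (by norm_num) (le_refl 1) hc0 hd'0
  have hG0 : ∀ W, 0 ≤ G W := fun W => mul_nonneg (hν0 W) (hm0 W)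
  have hG'0 : ∀ W, 0 ≤ G' W := fun W => mul_nonneg (hν0 W) (hm'0 W)
  have hmix := mixture_lsm ent ent' ρ hρ0 hρ1 c d hc0 hd0 hdc hcc hdd hcd hratio
  have hmix' := mixture_lsm ent ent' 1 (by norm_num) (le_refl 1) c d' hc0 hd'0 hd'c hcc hd'd' hcd'
    hratio'
  have wLL : ∀ s ⊆ U, ∀ t ⊆ U, G s * G t ≤ G (s ∩ t) * G (s ∪ t) := by
    intro s hs t ht
    simp only [hGdef]
    calc ν s * chainMix ent ent' ρ c d s * (ν t * chainMix ent ent' ρ c d t)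
        = (ν s * ν t) * (chainMix ent ent' ρ c d s * chainMix ent ent' ρ c d t) := by ring
      _ ≤ (ν (s ∩ t) * ν (s ∪ t)) *
            (chainMix ent ent' ρ c d (s ∩ t) * chainMix ent ent' ρ c d (s ∪ t)) :=
          mul_le_mul (hν s hs t ht) (hmix s t) (mul_nonneg (hm0 _) (hm0 _))
            (mul_nonneg (hν0 _) (hν0 _))
      _ = _ := by ring
  have wMM : ∀ s ⊆ U, ∀ t ⊆ U, G' s * G' t ≤ G' (s ∩ t) * G' (s ∪ t) := by
    intro s hs t ht
    simp only [hG'def]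
    calc ν s * chainMix ent ent' 1 c d' s * (ν t * chainMix ent ent' 1 c d' t)
        = (ν s * ν t) * (chainMix ent ent' 1 c d' s * chainMix ent ent' 1 c d' t) := by ring
      _ ≤ (ν (s ∩ t) * ν (s ∪ t)) *
            (chainMix ent ent' 1 c d' (s ∩ t) * chainMix ent ent' 1 c d' (s ∪ t)) :=
          mul_le_mul (hν s hs t ht) (hmix' s t) (mul_nonneg (hm'0 _) (hm'0 _))
            (mul_nonneg (hν0 _) (hν0 _))
      _ = _ := by ring
  have wML : ∀ s ⊆ U, ∀ t ⊆ U, (∃ r ∈ ent ∪ ent', r ∈ s) →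
      G' s * G t ≤ G (s ∩ t) * G' (s ∪ t) := by
    intro s hs t ht hse
    have hsu : ∃ r ∈ ent ∪ ent', r ∈ s ∪ t := by
      obtain ⟨r, hr, hrs⟩ := hse; exact ⟨r, hr, Finset.mem_union_left _ hrs⟩
    simp only [hGdef, hG'def]
    rw [chainMix_one_of_meet ent ent' c d' hse, chainMix_one_of_meet ent ent' c d' hsu]
    calc ν s * d' s * (ν t * chainMix ent ent' ρ c d t)
        = (ν s * ν t) * (d' s * chainMix ent ent' ρ c d t) := by ring
      _ ≤ (ν (s ∩ t) * ν (s ∪ t)) * (chainMix ent ent' ρ c d (s ∩ t) * d' (s ∪ t)) :=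
          mul_le_mul (hν s hs t ht)
            (chain_cross_holley ent ent' ρ hρ0 hρ1 c d d' hdc hcd' hdd' hd'0 s t)
            (mul_nonneg (hd'0 _) (hm0 _)) (mul_nonneg (hν0 _) (hν0 _))
      _ = _ := by ring
  have hI : ∀ W, W ∩ (ent ∪ ent') = ∅ → G' W = G W := by
    intro W hW
    have hno : ¬ ∃ r ∈ ent ∪ ent', r ∈ W := by
      rintro ⟨r, hr, hrW⟩
      have : r ∈ W ∩ (ent ∪ ent') := Finset.mem_inter.mpr ⟨hrW, hr⟩
      rw [hW] at this
      exact Finset.notMem_empty r this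
    simp only [hGdef, hG'def]
    rw [chainMix_of_not_meet ent ent' ρ c d hno, chainMix_of_not_meet ent ent' 1 c d' hno]
  have hx0 : ∀ W : Finset V, (0 : R) ≤ (if m₁ ∈ W then (1 : R) else 0) := by
    intro W; split_ifs <;> norm_num
  have hy0 : ∀ W : Finset V, (0 : R) ≤ (if m₂ ∈ W then (1 : R) else 0) := by
    intro W; split_ifs <;> norm_num
  have hxm : ∀ s t : Finset V,
      (if m₁ ∈ s then (1 : R) else 0) ≤ (if m₁ ∈ s ∪ t then (1 : R) else 0) := by
    intro s t
    by_cases h : m₁ ∈ s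
    · rw [if_pos h, if_pos (Finset.mem_union_left t h)]
    · rw [if_neg h]; split_ifs <;> norm_num
  have hym : ∀ s t : Finset V,
      (if m₂ ∈ s then (1 : R) else 0) ≤ (if m₂ ∈ s ∪ t then (1 : R) else 0) := by
    intro s t
    by_cases h : m₂ ∈ s
    · rw [if_pos h, if_pos (Finset.mem_union_left t h)]
    · rw [if_neg h]; split_ifs <;> norm_num
  exact gate_functional_nonneg U (ent ∪ ent') G G' (fun W => if m₁ ∈ W then (1 : R) else 0)
    (fun W => if m₂ ∈ W then (1 : R) else 0) hG0 hG'0 hx0 hy0 hxm hym wLL wMM wML hI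

end ChainWorld1

end Summit.Ventures.PercRepro2.Coin
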